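import Mathlib
import HarnessLib
import Literature.Computability.AlgebraicComplexity.AsymptoticSpectrum
import Literature.Computability.AlgebraicComplexity.BorderRankCW
import Summits.MatrixMultiplication.MatrixMultiplication.Theorems.OutsiderSandwichToricCeiling
import Summits.MatrixMultiplication.MatrixMultiplication.Theorems.OutsiderSandwichToricCeilingMonomial

/-!
# OutsiderSandwich — the toric ceiling of `cw₂ ⊠ cw₂` in the MIXED product basis `cw ⊠ D`
(decomp-mm lens 4, gen 43, kernel K43-3; THESES-FREE, `ω`-free; completes K43-1/K43-2 over all four
product bases `{cw, D} × {cw, D}` of `cw₂^{⊠2}`; helper toward `LaserTangency`, stmt-32268)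

WHAT.  K43-1 (`OutsiderSandwichToricCeiling`) excluded diagonal combinatorial degenerations of size
`≥ 8` in the support frames of `cw₂ ⊠ cw₂` for the bases `cw ⊠ cw` (`cwFrame`) and `D ⊠ D`
(`tightFrame`), and K43-2 (`…Monomial`) turned that into `r ≤ 7` for every monomial certificate of
`⟨r⟩`.  A monomial certificate may, however, use DIFFERENT bases in the two Kronecker factors.  This
file closes the remaining product bases: the mixed frame `mixedFrame` = support of `cw₂ ⊠ D`
(coordinate 1 in the Coppersmith–Winograd pattern, coordinate 2 in the permutation pattern; the
fourth basis `D ⊠ cw` is its coordinate swap and is covered by the same theorem up to `Prod.swap`,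
see `swappedFrame_no_diagonal_comb_degeneration_eight`).

* `mixedFrame_no_diagonal_comb_degeneration_eight`, `swappedFrame_no_diagonal_comb_degeneration_
  eight`: no diagonal `Ψ` with `#Ψ ≥ 8` is a combinatorial degeneration (weights in any linearly
  ordered commutative ring);
* `mixed_monomial_certificate_le_seven`: the verbatim hypotheses of `isApproxRestriction_of_monomial`
  for the host `kroneckerTensor (cwTensor F 2) D` (`D a b c = [a, b, c pairwise distinct]`) and
  target `unitTensor F r` force `r ≤ 7`.

WHY THE SAME CERTIFICATE WORKS (the product structure behind K43-1).  For a star `s` the certificate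
`H(s)` = frame triples with exactly one coordinate deranged from `s` is `D₁ × N₂ ∪ N₁ × D₂`
(`D_c` / `N_c` = the factor-frame triples deranged / not deranged from `s_c`).  Its leg fibre over a
point `(i, j)` is `d₁(i)·n₂(j) + n₁(i)·d₂(j)`, and in BOTH factor patterns (cw and permutation) one
has `(d, n) = (0, 2)` at the star's value and `(1, 1)` elsewhere — so the fibre is `0` at the star
point and `2` at every other point, whatever the two patterns are.  (The same computation gives, for
`cw₂^{⊠N}` in any product basis, the `2^{N-1}`-regular certificate "odd number of deranged
coordinates"; recorded in the node memo, not formalised here.)  Exact LP census for the mixed frame: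
none of its `216` size-8 diagonals is a combinatorial degeneration (now a theorem); `504` of its
`2088` size-7 diagonals are (cw frame: `672 / 1968`; tight frame: `0 / 2952`).

HONEST SCOPE.  As K43-1/2: statements about toric / monomial certificates, not about
`AlgDegeneratesTo (kroneckerPow (cwTensor ℂ 2) 2) (unitTensor ℂ 8)`, which stays open.
-/

set_option linter.dupNamespace false

namespace Summit.MatrixMultiplication.MatrixMultiplication.Theorems.OutsiderSandwichToricCeilingMixed

open Finset
open Literature.Computability.AlgebraicComplexity
open Summit.MatrixMultiplication.MatrixMultiplication.Theorems.OutsiderSandwichToricCeiling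
open Summit.MatrixMultiplication.MatrixMultiplication.Theorems.OutsiderSandwichToricCeilingMonomial

/-- The MIXED frame: support of `cw₂ ⊠ D` — coordinate 1 in the cw pattern, coordinate 2 in the
permutation pattern (36 triples). [new] -/
def mixedFrame : Finset Tr :=
  univ.filter fun t => cwSlot t.1.1 t.2.1.1 t.2.2.1 = true ∧ dSlot t.1.2 t.2.1.2 t.2.2.2 = true

/-- The SWAPPED mixed frame: support of `D ⊠ cw₂`. [new] -/
def swappedFrame : Finset Tr :=
  univ.filter fun t => dSlot t.1.1 t.2.1.1 t.2.2.1 = true ∧ cwSlot t.1.2 t.2.1.2 t.2.2.2 = true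

/-! ## Finite facts (kernel `decide`) -/

set_option maxRecDepth 100000

/-- Both mixed frames have 36 triples and are 4-regular on every leg. [new] -/
theorem mixed_regular : (36 = #mixedFrame ∧ 36 = #swappedFrame) ∧ ∀ p : Pt,
    (#{t ∈ mixedFrame | t.1 = p} = 4 ∧ #{t ∈ mixedFrame | t.2.1 = p} = 4 ∧
      #{t ∈ mixedFrame | t.2.2 = p} = 4) ∧
    (#{t ∈ swappedFrame | t.1 = p} = 4 ∧ #{t ∈ swappedFrame | t.2.1 = p} = 4 ∧
      #{t ∈ swappedFrame | t.2.2 = p} = 4) := by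
  decide +kernel

/-- Value counts, frame `cw ⊠ D`: `0` exactly once in both coordinates; in the cw coordinate the
values `1, 2` an even number of times, in the permutation coordinate exactly once. [new] -/
theorem cnt_mixed : ∀ t ∈ mixedFrame, (cnt₁ 0 t = 1 ∧ cnt₂ 0 t = 1) ∧
    ∀ α : Fin 3, α ≠ 0 → Even (cnt₁ α t) ∧ cnt₂ α t = 1 := by
  decide +kernel

/-- Value counts, frame `D ⊠ cw`. [new] -/
theorem cnt_swapped : ∀ t ∈ swappedFrame, (cnt₁ 0 t = 1 ∧ cnt₂ 0 t = 1) ∧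
    ∀ α : Fin 3, α ≠ 0 → cnt₁ α t = 1 ∧ Even (cnt₂ α t) := by
  decide +kernel

/-- The certificate `H(s)` (exactly one coordinate deranged) has 16 triples, avoids the star points
and covers every other point of every leg exactly twice — in both mixed frames, for every star. [new] -/
theorem cert_fibres_mixed : ∀ s ∈ tightFrame,
    (#(cert mixedFrame s) = 16 ∧ #(cert swappedFrame s) = 16) ∧
    ∀ p : Pt, (#{t ∈ cert mixedFrame s | t.1 = p} = (if p = s.1 then 0 else 2) ∧
      #{t ∈ cert mixedFrame s | t.2.1 = p} = (if p = s.2.1 then 0 else 2) ∧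
      #{t ∈ cert mixedFrame s | t.2.2 = p} = (if p = s.2.2 then 0 else 2)) ∧
    (#{t ∈ cert swappedFrame s | t.1 = p} = (if p = s.1 then 0 else 2) ∧
      #{t ∈ cert swappedFrame s | t.2.1 = p} = (if p = s.2.1 then 0 else 2) ∧
      #{t ∈ cert swappedFrame s | t.2.2 = p} = (if p = s.2.2 then 0 else 2)) := by
  decide +kernel

/-! ## The theorems -/

section Main

variable {R : Type*} [CommRing R] [LinearOrder R] [IsStrictOrderedRing R]

/-- **Toric ceiling, mixed frame `cw ⊠ D`.** No diagonal with at least `8` triples is a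
combinatorial degeneration. [new] -/
theorem mixedFrame_no_diagonal_comb_degeneration_eight {Ψ : Finset Tr} {a b c : Pt → R}
    (hsub : Ψ ⊆ mixedFrame) (hzero : ∀ t ∈ Ψ, a t.1 + b t.2.1 + c t.2.2 = 0)
    (hone : ∀ t ∈ mixedFrame, t ∉ Ψ → 1 ≤ a t.1 + b t.2.1 + c t.2.2)
    (hdiag : isDiagonal Ψ = true) (h8 : 8 ≤ #Ψ) : False := by
  refine no_diagonal_eight_of_facts hzero hone hdiag h8 mixed_regular.1.1
    (fun p => (mixed_regular.2 p).1) (fun t ht => (cnt_mixed t (hsub ht)).1) (fun hΨ α hα => ?_)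
    (fun s hs => (cert_fibres_mixed s hs).1.1) (fun s hs p => ((cert_fibres_mixed s hs).2 p).1)
  refine ⟨Finset.even_sum _ fun t ht => ((cnt_mixed t (hsub ht)).2 α hα).1, ?_⟩
  rw [Finset.sum_congr rfl fun t ht => ((cnt_mixed t (hsub ht)).2 α hα).2, Finset.sum_const,
    smul_eq_mul, mul_one, hΨ]
  decide

/-- **Toric ceiling, swapped mixed frame `D ⊠ cw`.** [new] -/
theorem swappedFrame_no_diagonal_comb_degeneration_eight {Ψ : Finset Tr} {a b c : Pt → R}
    (hsub : Ψ ⊆ swappedFrame) (hzero : ∀ t ∈ Ψ, a t.1 + b t.2.1 + c t.2.2 = 0)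
    (hone : ∀ t ∈ swappedFrame, t ∉ Ψ → 1 ≤ a t.1 + b t.2.1 + c t.2.2)
    (hdiag : isDiagonal Ψ = true) (h8 : 8 ≤ #Ψ) : False := by
  refine no_diagonal_eight_of_facts hzero hone hdiag h8 mixed_regular.1.2
    (fun p => (mixed_regular.2 p).2) (fun t ht => (cnt_swapped t (hsub ht)).1) (fun hΨ α hα => ?_)
    (fun s hs => (cert_fibres_mixed s hs).1.2) (fun s hs p => ((cert_fibres_mixed s hs).2 p).2)
  refine ⟨?_, Finset.even_sum _ fun t ht => ((cnt_swapped t (hsub ht)).2 α hα).2⟩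
  rw [Finset.sum_congr rfl fun t ht => ((cnt_swapped t (hsub ht)).2 α hα).1, Finset.sum_const,
    smul_eq_mul, mul_one, hΨ]
  decide

end Main

/-- BRIDGE: the mixed frame is the support of `cw₂ ⊠ D`. [new] -/
theorem kronecker_cw_diag_apply (K : Type) [Field K] {D : Fin 3 → Fin 3 → Fin 3 → K}
    (hD : ∀ a b c, D a b c = if a ≠ b ∧ b ≠ c ∧ a ≠ c then 1 else 0) (u v w : Pt) :
    kroneckerTensor (cwTensor K 2) D u v w = if (u, v, w) ∈ mixedFrame then 1 else 0 := by
  rw [kroneckerTensor_apply, cwTensor_apply, hD]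
  simp only [mixedFrame, cwSlot, dSlot, Finset.mem_filter, Finset.mem_univ, true_and,
    decide_eq_true_eq]
  by_cases h₁ : (u.1 = 0 ∧ v.1 = w.1 ∧ v.1 ≠ 0) ∨ (v.1 = 0 ∧ u.1 = w.1 ∧ u.1 ≠ 0) ∨
      (w.1 = 0 ∧ u.1 = v.1 ∧ u.1 ≠ 0) <;>
    by_cases h₂ : u.2 ≠ v.2 ∧ v.2 ≠ w.2 ∧ u.2 ≠ w.2 <;> simp [h₁, h₂]

/-- BRIDGE: the swapped frame is the support of `D ⊠ cw₂`. [new] -/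
theorem kronecker_diag_cw_apply (K : Type) [Field K] {D : Fin 3 → Fin 3 → Fin 3 → K}
    (hD : ∀ a b c, D a b c = if a ≠ b ∧ b ≠ c ∧ a ≠ c then 1 else 0) (u v w : Pt) :
    kroneckerTensor D (cwTensor K 2) u v w = if (u, v, w) ∈ swappedFrame then 1 else 0 := by
  rw [kroneckerTensor_apply, cwTensor_apply, hD]
  simp only [swappedFrame, cwSlot, dSlot, Finset.mem_filter, Finset.mem_univ, true_and,
    decide_eq_true_eq]
  by_cases h₁ : u.1 ≠ v.1 ∧ v.1 ≠ w.1 ∧ u.1 ≠ w.1 <;>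
    by_cases h₂ : (u.2 = 0 ∧ v.2 = w.2 ∧ v.2 ≠ 0) ∨ (v.2 = 0 ∧ u.2 = w.2 ∧ u.2 ≠ 0) ∨
      (w.2 = 0 ∧ u.2 = v.2 ∧ u.2 ≠ 0) <;> simp [h₁, h₂]

/-- **No monomial certificate of `⟨r⟩` from `cw₂ ⊠ D` (mixed bases) has `r ≥ 8`.** [new] -/
theorem mixed_monomial_certificate_le_seven (F : Type) [Field F]
    {D : Fin 3 → Fin 3 → Fin 3 → F} (hD : ∀ a b c, D a b c = if a ≠ b ∧ b ≠ c ∧ a ≠ c then 1 else 0)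
    {r K : ℕ} (σA σB σC : Fin r → Pt) (α β γ : Fin r → ℕ)
    (h₁ : ∀ x y z, α x + β y + γ z < K → kroneckerTensor (cwTensor F 2) D (σA x) (σB y) (σC z) = 0)
    (h₂ : ∀ x y z, (if α x + β y + γ z = K then kroneckerTensor (cwTensor F 2) D (σA x) (σB y) (σC z)
      else 0) = unitTensor F r x y z) : r ≤ 7 := by
  refine le_seven_of_frame_certificate (Φ := mixedFrame) (K := K)
    (fun Ψ a b c hs hz ho hd h8 => mixedFrame_no_diagonal_comb_degeneration_eight hs hz ho hd h8)
    σA σB σC α β γ (fun x y z hlt hmem => ?_) (fun x y z => ?_)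
  · have h := h₁ x y z hlt
    rw [kronecker_cw_diag_apply F hD, if_pos hmem] at h
    exact one_ne_zero h
  · have h := h₂ x y z
    rw [kronecker_cw_diag_apply F hD, unitTensor_apply] at h
    constructor
    · rintro ⟨hmem, heq⟩
      rw [if_pos heq, if_pos hmem] at h
      by_contra hne; rw [if_neg hne] at h; exact one_ne_zero h
    · rintro ⟨rfl, rfl⟩
      rw [if_pos (show x = x ∧ x = x from ⟨rfl, rfl⟩)] at h
      by_cases heq : α x + β x + γ x = K
      · rw [if_pos heq] at h
        by_cases hmem : (σA x, σB x, σC x) ∈ mixedFrame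
        · exact ⟨hmem, heq⟩
        · rw [if_neg hmem] at h; exact absurd h zero_ne_one
      · rw [if_neg heq] at h; exact absurd h zero_ne_one

/-- **Nor from `D ⊠ cw₂`.** [new] -/
theorem swapped_monomial_certificate_le_seven (F : Type) [Field F]
    {D : Fin 3 → Fin 3 → Fin 3 → F} (hD : ∀ a b c, D a b c = if a ≠ b ∧ b ≠ c ∧ a ≠ c then 1 else 0)
    {r K : ℕ} (σA σB σC : Fin r → Pt) (α β γ : Fin r → ℕ)
    (h₁ : ∀ x y z, α x + β y + γ z < K → kroneckerTensor D (cwTensor F 2) (σA x) (σB y) (σC z) = 0)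
    (h₂ : ∀ x y z, (if α x + β y + γ z = K then kroneckerTensor D (cwTensor F 2) (σA x) (σB y) (σC z)
      else 0) = unitTensor F r x y z) : r ≤ 7 := by
  refine le_seven_of_frame_certificate (Φ := swappedFrame) (K := K)
    (fun Ψ a b c hs hz ho hd h8 => swappedFrame_no_diagonal_comb_degeneration_eight hs hz ho hd h8)
    σA σB σC α β γ (fun x y z hlt hmem => ?_) (fun x y z => ?_)
  · have h := h₁ x y z hlt
    rw [kronecker_diag_cw_apply F hD, if_pos hmem] at h
    exact one_ne_zero h
  · have h := h₂ x y z
    rw [kronecker_diag_cw_apply F hD, unitTensor_apply] at h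
    constructor
    · rintro ⟨hmem, heq⟩
      rw [if_pos heq, if_pos hmem] at h
      by_contra hne; rw [if_neg hne] at h; exact one_ne_zero h
    · rintro ⟨rfl, rfl⟩
      rw [if_pos (show x = x ∧ x = x from ⟨rfl, rfl⟩)] at h
      by_cases heq : α x + β x + γ x = K
      · rw [if_pos heq] at h
        by_cases hmem : (σA x, σB x, σC x) ∈ swappedFrame
        · exact ⟨hmem, heq⟩
        · rw [if_neg hmem] at h; exact absurd h zero_ne_one
      · rw [if_neg heq] at h; exact absurd h zero_ne_one

end Summit.MatrixMultiplication.MatrixMultiplication.Theorems.OutsiderSandwichToricCeilingMixed
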